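import Summits.QuantumFields.GaugeBoot.StrongCouplingWilsonLoopDecayLimit
import Summits.QuantumFields.GaugeBoot.EquipartitionWilsonLoops
import HarnessLib

/-!
# Strong coupling from the loop equation: explicit lower bounds on the static potential, `V(1) ≥ log(1/a)`, `V(R ≥ 2) ≥ 2 log(1/a)` (gauge-boot, ADDENDUM 26 part E)

HONEST FRAMING (cell `pub-gaugeboot`, page 1 of every file): the venture produces certified bounds
on lattice expectations at stated coupling, gauge group, dimension and torus size; NOT a mass gap,
NOT a continuum limit, NOT a string tension; NOT Yang–Mills-summit-bearing (barriers
`FixedCouplingUltralocality`, `PerturbativeInvisibility`).  Explicit strong-coupling LOWER bounds on the first values of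
the static quark–antiquark potential of every infinite-volume limit state; NOT confinement (no growth in `R` is shown beyond
`R = 2`: the Wilson-loop exponent of part C is the perimeter, not the area), NO string tension is bounded; no number of
CERTIFIED.md is touched.

## Content (`SU(N)`, `N ≥ 2`, `D ≥ 2`, standard coupling `β_std > 0`, tree coupling `β_std/N`)

The tree (`EquipartitionWilsonLoops`, from reflection positivity) proves that every infinite-volume limit point `μ` of the
`SU(N)` torus Wilson states at `β_std > 0` has a static potential `V_μ(R) = lim_T −log|W_μ(R × T)|/T` at every separation.
Parts C/D bound `|W_μ(R × T)|` by `a^T` (`R = 1`) and by `a^{2(R+T)−4} ≤ (a²)^T` (`R, T ≥ 2`, `a ≤ 1`),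
`a = 4(D−1)β_std/(N²−1)`:

* `le_of_hasStaticPotential_of_eventually_le` — if `|W(R,T)| ≤ q^T` eventually with `0 < q`, then `V(R) ≥ −log q`;
* ★★★ `log_le_staticPotential_one` — **`V_μ(1) ≥ log((N²−1)/(4(D−1)β_std))`**; ★★★ `two_mul_log_le_staticPotential` —
  **`V_μ(R) ≥ 2·log((N²−1)/(4(D−1)β_std))` for every `R ≥ 2`**, for every limit point, whenever `4(D−1)β_std ≤ N²−1`
  (`SU(3)`, `D = 4`: `V(1) ≥ log(2/(3β))`, `V(R ≥ 2) ≥ 2 log(2/(3β))` for `β ≤ 2/3`).  The strong-coupling series gives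
  `V(R) ≈ R·log(2N²/β_std)`: the two bounds are its first two steps with a cruder constant, and nothing beyond.

References: E. Seiler, *Gauge theories as a problem of constructive quantum field theory* (LNP 159, 1982) §2 (static
potential from RP); I. Montvay, G. Münster, *Quantum fields on a lattice* (1994) §3.4.5.  Everything is `[folklore]`.
-/

noncomputable section

open MeasureTheory Filter Topology
open Literature.MathematicalPhysics.QuantumFieldTheory
open Literature.MathematicalPhysics.QuantumLattice (LGConfig infiniteVolumeLimitPoints rectExpectation normalisedCharacter
  HasStaticPotential staticPotential fundamentalRep)

namespace Summit.QuantumFields.GaugeBoot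

namespace StrongCoupling

variable {D N : ℕ} [NeZero D]

/-- **From a geometric bound to the static potential.**  If the static potential `V` of `μ` at separation `R` exists and
`|W_μ(R × T)| ≤ q^T` for all large `T`, then `−log q ≤ V`. [folklore] -/
theorem le_of_hasStaticPotential_of_eventually_le {G : Type*} [Group G] [MeasurableSpace G]
    {μ : Measure (LGConfig D G)} {χ : G → ℝ} {R : ℕ} {V q : ℝ} (hV : HasStaticPotential μ χ R V)
    (hb : ∀ᶠ T : ℕ in atTop, |rectExpectation μ χ 0 1 R T| ≤ q ^ T) : -Real.log q ≤ V := by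
  refine ge_of_tendsto hV.2 ?_
  filter_upwards [hV.1, hb, eventually_ge_atTop 1] with T hne hle hT
  have hpos : 0 < |rectExpectation μ χ 0 1 R T| := abs_pos.2 hne
  have hlog : Real.log |rectExpectation μ χ 0 1 R T| ≤ (T : ℝ) * Real.log q := by
    rw [← Real.log_pow]; exact Real.log_le_log hpos hle
  have hT0 : (0 : ℝ) < T := by exact_mod_cast hT
  rw [le_div_iff₀ hT0]
  linarith

omit [NeZero D] in
/-- The decay constant `a = 4(D−1)β/(N²−1)` is positive for `β > 0`, `N ≥ 2`, `D ≥ 2`. [folklore] -/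
theorem decayConst_pos (hN : 2 ≤ N) (hD : 2 ≤ D) {β : ℝ} (hβ : 0 < β) :
    0 < 4 * ((D : ℝ) - 1) * |β| / ((N : ℝ) ^ 2 - 1) := by
  have hN2 : (2 : ℝ) ≤ N := by exact_mod_cast hN
  have hD2 : (2 : ℝ) ≤ D := by exact_mod_cast hD
  have h1 : (0 : ℝ) < (N : ℝ) ^ 2 - 1 := by nlinarith
  have h2 : (0 : ℝ) < (D : ℝ) - 1 := by linarith
  rw [abs_of_pos hβ]
  positivity

omit [NeZero D] in
/-- `−log a = log((N²−1)/(4(D−1)β))` for `β > 0`. [folklore] -/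
theorem neg_log_decayConst {β : ℝ} (hβ : 0 < β) :
    -Real.log (4 * ((D : ℝ) - 1) * |β| / ((N : ℝ) ^ 2 - 1)) = Real.log (((N : ℝ) ^ 2 - 1) / (4 * ((D : ℝ) - 1) * β)) := by
  rw [← Real.log_inv, inv_div, abs_of_pos hβ]

omit [NeZero D] in
/-- In the statement of the static potential the two conventions for the character agree. [folklore] -/
theorem rectExpectation_comp_eq (μ : Measure (LGConfig D (SU N))) (i j : Fin D) (R T : ℕ) :
    rectExpectation μ (normalisedCharacter N ∘ suRep N) i j R T =
      rectExpectation μ (fun g => normalisedCharacter N (fundamentalRep (Fin N) g)) i j R T := rfl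

/-- `(0 : Fin D) ≠ 1` for `D ≥ 2`. [folklore] -/
theorem fin_zero_ne_one (hD : 2 ≤ D) : (0 : Fin D) ≠ 1 := by
  intro h
  have := congrArg Fin.val h
  simp [Nat.one_mod_eq_one.mpr (by omega : D ≠ 1)] at this

/-- ★★★ **`V(1) ≥ log((N²−1)/(4(D−1)β_std))`**: for `SU(N)`, `N ≥ 2`, `D ≥ 2`, `β_std > 0`, every infinite-volume limit point
`μ` of the torus Wilson states at tree coupling `β_std/N`: the static potential at separation one is at least
`log((N²−1)/(4(D−1)β_std))` (positive as soon as `4(D−1)β_std < N²−1`). [folklore] -/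
theorem log_le_staticPotential_one (hN : 2 ≤ N) (hD : 2 ≤ D) {β : ℝ} (hβ : 0 < β)
    {μ : Measure (LGConfig D (SU N))} (hμ : μ ∈ infiniteVolumeLimitPoints (d := D) (suRep N) (β / N)) :
    Real.log (((N : ℝ) ^ 2 - 1) / (4 * ((D : ℝ) - 1) * β)) ≤
      staticPotential μ (fun g => normalisedCharacter N (fundamentalRep (Fin N) g)) 1 := by
  have hNpos : (0 : ℝ) < N := by exact_mod_cast (show 0 < N by omega)
  have hV := EquipartitionZd.hasStaticPotential_of_mem_limitPoints hN hD (div_pos hβ hNpos) hμ 1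
  rw [← neg_log_decayConst (N := N) (D := D) hβ]
  refine le_of_hasStaticPotential_of_eventually_le hV ?_
  filter_upwards [eventually_ge_atTop 1] with T hT
  rw [← rectExpectation_comp_eq]
  exact abs_rectExpectation_le_pow_snd_of_mem_limitPoints hN hD β hμ (fin_zero_ne_one hD) le_rfl hT

/-- ★★★ **`V(R) ≥ 2·log((N²−1)/(4(D−1)β_std))` for every `R ≥ 2`**: for `SU(N)`, `N ≥ 2`, `D ≥ 2`, `0 < β_std` with
`4(D−1)β_std ≤ N²−1`, every infinite-volume limit point `μ` at tree coupling `β_std/N` and every separation `R ≥ 2`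
(from `|W_μ(R × T)| ≤ a^{2(R+T)−4} ≤ (a²)^T`). [folklore] -/
theorem two_mul_log_le_staticPotential (hN : 2 ≤ N) (hD : 2 ≤ D) {β : ℝ} (hβ : 0 < β)
    (hβa : 4 * ((D : ℝ) - 1) * β ≤ (N : ℝ) ^ 2 - 1)
    {μ : Measure (LGConfig D (SU N))} (hμ : μ ∈ infiniteVolumeLimitPoints (d := D) (suRep N) (β / N)) {R : ℕ} (hR : 2 ≤ R) :
    2 * Real.log (((N : ℝ) ^ 2 - 1) / (4 * ((D : ℝ) - 1) * β)) ≤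
      staticPotential μ (fun g => normalisedCharacter N (fundamentalRep (Fin N) g)) R := by
  have hNpos : (0 : ℝ) < N := by exact_mod_cast (show 0 < N by omega)
  have hV := EquipartitionZd.hasStaticPotential_of_mem_limitPoints hN hD (div_pos hβ hNpos) hμ R
  set a : ℝ := 4 * ((D : ℝ) - 1) * |β| / ((N : ℝ) ^ 2 - 1) with ha
  have ha0 : 0 < a := decayConst_pos hN hD hβ
  have ha1 : a ≤ 1 := by
    have hN2 : (2 : ℝ) ≤ N := by exact_mod_cast hN
    have h1 : (0 : ℝ) < (N : ℝ) ^ 2 - 1 := by nlinarith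
    rw [ha, div_le_one h1, abs_of_pos hβ]; exact hβa
  have hlog : 2 * Real.log (((N : ℝ) ^ 2 - 1) / (4 * ((D : ℝ) - 1) * β)) = -Real.log (a ^ 2) := by
    rw [Real.log_pow, ← neg_log_decayConst (N := N) (D := D) hβ]; push_cast; ring
  rw [hlog]
  refine le_of_hasStaticPotential_of_eventually_le hV ?_
  filter_upwards [eventually_ge_atTop 2] with T hT
  rw [← rectExpectation_comp_eq, ← pow_mul]
  refine (abs_rectExpectation_le_pow_of_mem_limitPoints hN hD β hμ (fin_zero_ne_one hD) hR hT).trans ?_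
  exact pow_le_pow_of_le_one ha0.le ha1 (by omega)

/-- `SU(3)`, `D = 4`, `0 < β ≤ 2/3`: `V(1) ≥ log(2/(3β))` and `V(R) ≥ 2 log(2/(3β))` (`R ≥ 2`) at every limit point.
[folklore] -/
theorem log_le_staticPotential_three_four {β : ℝ} (hβ : 0 < β) (hβa : β ≤ 2 / 3) {μ : Measure (LGConfig 4 (SU 3))}
    (hμ : μ ∈ infiniteVolumeLimitPoints (d := 4) (suRep 3) (β / 3)) {R : ℕ} (hR : 1 ≤ R) :
    (if R = 1 then 1 else 2) * Real.log (2 / (3 * β)) ≤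
      staticPotential μ (fun g => normalisedCharacter 3 (fundamentalRep (Fin 3) g)) R := by
  have hlog : Real.log (2 / (3 * β)) = Real.log ((((3 : ℕ) : ℝ) ^ 2 - 1) / (4 * (((4 : ℕ) : ℝ) - 1) * β)) := by
    congr 1; push_cast; field_simp; ring
  rw [hlog]
  split_ifs with h1
  · subst h1
    rw [one_mul]
    exact log_le_staticPotential_one (N := 3) (D := 4) (by norm_num) (by norm_num) hβ (by exact_mod_cast hμ)
  · exact two_mul_log_le_staticPotential (N := 3) (D := 4) (by norm_num) (by norm_num) hβ (by push_cast; linarith)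
      (by exact_mod_cast hμ) (by omega)

end StrongCoupling

end Summit.QuantumFields.GaugeBoot

end
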